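import Summits.ValiantsHypothesis.ValiantsHypothesis.Theorems.GrenetZeonDualUnipotentThreeHalvesSlowCoreGlue
import Summits.ValiantsHypothesis.ValiantsHypothesis.Theorems.GrenetZeonDualUnipotentThreeHalvesLongMassPerPencilPrice

/-!
# `GrenetZeon.DualUnipotentThreeHalves` (stmt-ValiantsHypothesis-24318), line `slow_core`, stub (c) `SlowCore.LongMassSlowLawInv`:
# THE GLUE, LOCALISED — and ★ every small unipotent-dual representation of `per_n` CONTAINS a (c)-violating irreducible constituent

✓ `SlowCore.slow_of_longMassSlowLawInv` (glue kernel III) consumes (c) as a GLOBAL law (`∀` irreducible nilpotent affine pencils).  Its proof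
uses (c) only on the IRREDUCIBLE DIAGONAL CLASSES of size `≥ ⌊√n⌋ + 1` of ONE block-triangular conjugate `G·N·G⁻¹` of the given pencil
(✓ `HeavyTopCompositionBound.exists_block_conj`).  This file re-runs that proof with the law replaced by exactly those per-constituent
certificates (§1), and contraposes it against ✓ `PerPencilPrice.not_slow_of_perPoly_eq_trace` (a `per_n`-representing pencil is never slow):

* §1 `slow_of_constituent_certs` — **LOCAL GLUE**: an affine nilpotent pencil `N` of the regime `(c+18)²·m² < n³` (`n ≥ 2`) is `Slow` as soon as
  every CONSTITUENT — a class pencil `classPencil (G·N·G') e` of a level-cut conjugate (`G'G = GG' = 1`), irreducible (`IrreducibleInv`),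
  nilpotent, of size `b ≥ ⌊√n⌋ + 1` — has a certificate `RelCert n b · (c·(⌊√n⌋·b))`.  (Verbatim the LARGE-`m` branch of the glue; the SMALL-`m`
  branch needs no certificate at all.)
* §2 ★★★ `exists_expensive_constituent_of_perPoly_eq_trace` — **SMALL REPRESENTATIONS ARE VIOLATOR FACTORIES**: if `per_n = tr(N^{n−1}·M)` with
  `N`, `M` affine, `N^m = 0`, `n ≥ 2` and `(c+18)²·m² < n³`, then some constituent `B` of `N` (in the above sense) is an IRREDUCIBLE nilpotent
  affine pencil of size `b ≥ ⌊√n⌋ + 1` with NO certificate of price `≤ c·(⌊√n⌋·b)` — a violator of (c) at constant `c`, sitting inside the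
  Jordan–Hölder block form of the representation.  (8062-side twin: ✓ `…DualUnipotentWildCore.exists_large_irreducible_block` only says LARGE;
  here the block is (c)-EXPENSIVE, so the whole VIOLATOR PORTRAIT ✓ `…NilSpaceViolatorPortrait{,Two}` applies to it: fat, long, of large rank,
  wild.)
* §3 `exists_expensive_constituent_of_dualUnipotentRepr` — the same in the stub's currency `DualUnipotentRepr n m`.

READING (repair census of the 28th hand).  The R3 door of the census («exhibit a (c)-violator family: fat ∧ long ∧ wild; 0 known members») and the
cruxes 24318 / 8062 are ONE search: a unipotent-dual representation of `per_n` of width `m = o(n^{3/2})` would hand over, constructively, a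
(c)-violating irreducible nilpotent pencil of size `> √n` for every constant `c`; conversely (c) kills all such representations (✓ glue).  Nothing here
decides either.

HONEST FRAMING.  A localisation of a landed reduction plus a contrapositive (`--supports stmt-ValiantsHypothesis-24318 --as helper`); (c)
`SlowCore.LongMassSlowLawInv` (research), S3, the crux 24318, `stub_dualUnipotent` / 8062 and `VP ≠ VNP` are NOT proved.  Def-free (the constituent
notion is spelled out with the tree's `SlowCore.classPencil` / `LevelCut`), no named-fact hypotheses, no sorry.
-/

-- single-conjunct layout: Sub = Summit, duplicated namespace component intended (the name is mandated)
set_option linter.dupNamespace false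
set_option autoImplicit false

noncomputable section

namespace Summit.ValiantsHypothesis.ValiantsHypothesis.Theorems.GrenetZeon.SlowCore

open MvPolynomial Matrix
open scoped BigOperators
open Literature.Computability.AlgebraicComplexity (perPoly)
open Summit.ValiantsHypothesis.ValiantsHypothesis.Cruxes.TwoDimCoefficients.DimTwoCases
  (AffMat IsAffine DualUnipotentRepr exists_nilpotent_pencil_of_dualUnipotentRepr)
open Summit.ValiantsHypothesis.ValiantsHypothesis.Theorems.GrenetZeon.RadicalSplit (lineSubst)
open Summit.ValiantsHypothesis.ValiantsHypothesis.Theorems.GrenetZeon.PerPencilPrice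
  (not_slow_of_perPoly_eq_trace isAffine_of_isHomogeneous_one)

section LocalGlue

variable {n m : ℕ}

open Summit.ValiantsHypothesis.ValiantsHypothesis.Theorems.GrenetZeon.HeavyTopCompositionBound (exists_block_conj) in
/-- ★ **LOCAL GLUE.**  An affine nilpotent pencil of the regime `(c+18)²·m² < n³`, `n ≥ 2`, all of whose irreducible constituents of size
`≥ ⌊√n⌋ + 1` carry a certificate of price `≤ c·(⌊√n⌋·size)`, is `Slow`.  (The proof of ✓ `slow_of_longMassSlowLawInv` with the global law
replaced by the per-constituent hypothesis `hcert`; a constituent is a class pencil of a level-cut constant conjugate.) [this file] -/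
theorem slow_of_constituent_certs (c : ℕ) (hn2 : 2 ≤ n) (hreg : (c + 18) ^ 2 * m ^ 2 < n ^ 3)
    (N : AffMat n m) (hN : IsAffine N) (hnil : N ^ m = 0)
    (hcert : ∀ (b : ℕ) (B : AffMat n b), IsAffine B → B ^ b = 0 → IrreducibleInv B → Nat.sqrt n + 1 ≤ b →
      (∃ (G G' : Matrix (Fin m) (Fin m) ℂ) (lvl : Fin m → ℕ) (t : ℕ) (e : {i : Fin m // lvl i = t} ≃ Fin b),
        G' * G = 1 ∧ G * G' = 1 ∧ LevelCut (G.map C * N * G'.map C) lvl ∧ B = classPencil (G.map C * N * G'.map C) e) →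
      RelCert n b B (c * (Nat.sqrt n * b))) :
    Slow n m N := by
  classical
  set s := Nat.sqrt n with hs
  have hs1 : 1 ≤ s := Nat.le_sqrt.2 (by omega)
  have hss : s * s ≤ n := Nat.sqrt_le n
  have hnT : n < (s + 1) * (s + 1) := Nat.lt_succ_sqrt n
  have hreg' : (c + 18) * m < n * (s + 1) := regime_sqrt hreg
  by_cases hsmall : 3 * m < n
  · -- SMALL m: freeze everything
    set K0 : Submodule ℂ (Fin n × Fin n → ℂ) := freezeSpace N (Finset.univ : Finset (Fin m × Fin m)) with hK0
    have hfr : Freezes N (fun i j => (fun _ : Fin m => 0) i = 0 ∧ (fun _ : Fin m => 0) j = 0) K0 :=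
      fun i j _ v hv => linEntry_eq_zero_of_mem_freezeSpace N _ (Finset.mem_univ (i, j)) hv
    have hcut0 : LevelCut N (fun _ => 0) := fun i j h => absurd h (lt_irrefl _)
    have hL0 := ledger_class_of_frozen N hN hcut0 0 hfr
    have htop0 : Ledger n m N (fun _ => True) K0 0 := ledger_mono hL0 (fun _ _ => rfl) le_rfl le_rfl
    refine slow_of_slowR (slowR_of_ledger htop0 ?_)
    have hcod := codim_freezeSpace_le N (Finset.univ : Finset (Fin m × Fin m))
    rw [Finset.card_univ, Fintype.card_prod, Fintype.card_fin, ← hK0] at hcod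
    have h9 : 9 * (m * m) < n * n := by nlinarith
    have h10 : 2 * n ≤ n * n := Nat.mul_le_mul_right n hn2
    have hK0le := finrank_dir_le n K0
    omega
  · -- LARGE m (n ≤ 3m): composition series, certificates on big classes, freeze the merged small runs, stack
    push Not at hsmall
    have hm1 : 1 ≤ m := by omega
    obtain ⟨P, L, lvl, hlvl, _hLm, _hne, hblock, hirr⟩ :=
      exists_block_conj (Set.range fun x : Fin n × Fin n → ℂ => N.map (MvPolynomial.eval x))
    set G : Matrix (Fin m) (Fin m) ℂ := (P : Matrix (Fin m) (Fin m) ℂ) with hG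
    set G' : Matrix (Fin m) (Fin m) ℂ := (↑P⁻¹ : Matrix (Fin m) (Fin m) ℂ) with hG'
    have hGG : G' * G = 1 := Units.inv_mul P
    have hGG' : G * G' = 1 := Units.mul_inv P
    set N' : AffMat n m := G.map C * N * G'.map C with hN'def
    have hN'aff : IsAffine N' := isAffine_conj N hN G G'
    have hN'nil : N' ^ m = 0 := conj_pow_eq_zero N G G' hGG hGG' hnil
    have hcut : LevelCut N' lvl :=
      levelCut_of_values N' lvl fun x i j hij => by rw [hN'def, conj_map_eval]; exact hblock _ ⟨x, rfl⟩ i j hij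
    -- threshold and coarsening
    set T : ℕ := s + 1 with hTdef
    have hT : 0 < T := Nat.succ_pos s
    set lvl' : Fin m → ℕ := fun i => coarsen lvl T (lvl i) with hlvl'
    have hcut' : LevelCut N' lvl' := levelCut_mono hcut (coarsen lvl T) (coarsen_mono lvl hT)
    set P' : ℕ := 2 * (m / T) + 2 with hP'def
    have hP' : ∀ i, lvl' i < P' := fun i => coarsen_lt lvl T (lvl i)
    -- certificates on the big levels, transported to class ledgers of N'
    have hbig : ∀ t : ℕ, ∃ (K : Submodule ℂ (Fin n × Fin n → ℂ)) (k : ℕ), t < L → T ≤ lvlSize lvl t →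
        Ledger n m N' (fun i => lvl i = t) K k ∧ n * k + (n * n - Module.finrank ℂ K) ≤ c * (s * lvlSize lvl t) := by
      intro t
      by_cases ht : t < L ∧ T ≤ lvlSize lvl t
      · obtain ⟨htL, htb⟩ := ht
        have hcardt : Fintype.card {i : Fin m // lvl i = t} = lvlSize lvl t := by rw [Fintype.card_subtype]; rfl
        let e : {i : Fin m // lvl i = t} ≃ Fin (lvlSize lvl t) := Fintype.equivFinOfCardEq hcardt
        obtain ⟨K, k, hK, hprice⟩ := hcert (lvlSize lvl t) (classPencil N' e) (isAffine_classPencil N' hN'aff e)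
          (pow_card_eq_zero_of_pow_eq_zero _ (classPencil_pow_eq_zero N' hcut e hN'nil))
          (irreducibleInv_classPencil N G G' e (hirr t htL _ e)) htb
          ⟨G, G', lvl, t, e, hGG, hGG', hcut, rfl⟩
        exact ⟨K, k, fun _ _ => ⟨ledger_class_of_classPencil N' hcut e hK, hprice⟩⟩
      · exact ⟨⊤, 0, fun h1 h2 => absurd ⟨h1, h2⟩ ht⟩
    choose Kt kt hKt using hbig
    -- the freezing set: pairs of small-level coordinates in one merged class
    let Rrel : Fin m → Fin m → Prop := fun i j => lvlSize lvl (lvl i) < T ∧ lvlSize lvl (lvl j) < T ∧ lvl' i = lvl' j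
    set R : Finset (Fin m × Fin m) := Finset.univ.filter fun ij => Rrel ij.1 ij.2 with hRdef
    have hRcard : R.card ≤ m * (2 * T) := by
      refine card_filter_prod_le Rrel fun i => ?_
      by_cases hi : lvlSize lvl (lvl i) < T
      · refine le_of_lt (lt_of_le_of_lt (Finset.card_le_card fun j hj => ?_) (card_small_class_lt lvl hT (lvl' i)))
        simp only [Finset.mem_filter, Finset.mem_univ, true_and, Rrel] at hj ⊢
        exact ⟨hj.2.1, hj.2.2.symm⟩
      · have h0 : (Finset.univ.filter fun j => Rrel i j) = ∅ :=
          Finset.filter_false_of_mem fun j _ h => hi h.1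
        rw [h0, Finset.card_empty]; exact Nat.zero_le _
    set bigS : Finset ℕ := (Finset.range L).filter fun t => T ≤ lvlSize lvl t with hbigS
    set K : Submodule ℂ (Fin n × Fin n → ℂ) := freezeSpace N' R ⊓ bigS.inf Kt with hKdef
    set kb : ℕ → ℕ := fun q => ∑ t ∈ bigS.filter (fun t => coarsen lvl T t = q), kt t with hkbdef
    -- the class ledgers of the merged classes
    have hclass : ∀ q, q < P' → Ledger n m N' (fun i => lvl' i = q) K (kb q) := by
      intro q _
      by_cases hq : ∃ t ∈ bigS, coarsen lvl T t = q
      · obtain ⟨t, htS, htq⟩ := hq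
        have htL : t < L := Finset.mem_range.1 (Finset.mem_filter.1 htS).1
        have htb : T ≤ lvlSize lvl t := (Finset.mem_filter.1 htS).2
        refine ledger_mono (hKt t htL htb).1 (fun i hi => ?_) (inf_le_right.trans (Finset.inf_le htS)) ?_
        · exact eq_of_coarsen_eq_of_big lvl hT htb (by rw [htq]; exact hi)
        · exact Finset.single_le_sum (f := kt) (fun _ _ => Nat.zero_le _) (Finset.mem_filter.2 ⟨htS, htq⟩)
      · push Not at hq
        have hsm : ∀ i, lvl' i = q → lvlSize lvl (lvl i) < T := fun i hi => by
          by_contra hb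
          exact hq (lvl i) (Finset.mem_filter.2 ⟨Finset.mem_range.2 (hlvl i), not_lt.1 hb⟩) hi
        have hfr : Freezes N' (fun i j => lvl' i = q ∧ lvl' j = q) K := by
          intro i j hij v hv
          have hmem : (i, j) ∈ R :=
            Finset.mem_filter.2 ⟨Finset.mem_univ _, hsm i hij.1, hsm j hij.2, hij.1.trans hij.2.symm⟩
          exact linEntry_eq_zero_of_mem_freezeSpace N' R hmem (inf_le_left (b := bigS.inf Kt) hv)
        exact ledger_mono (ledger_class_of_frozen N' hN'aff hcut' q hfr) (fun _ h => h) le_rfl (Nat.zero_le _)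
    -- (b₀): stack the classes; (g3): back to N
    have htop : Ledger n m N' (fun _ => True) K ((∑ q ∈ Finset.range P', kb q) + (P' - 1)) :=
      shortMassLedger0_holds n m P' N' hN'aff lvl' hP' hcut' K kb hclass
    have htopN := ledger_top_of_conj N N' G G' hGG rfl htop
    refine slow_of_slowR (slowR_of_ledger htopN ?_)
    -- BUDGET
    have hsumk : ∑ q ∈ Finset.range P', kb q = ∑ t ∈ bigS, kt t :=
      Finset.sum_fiberwise_of_maps_to (fun t _ => Finset.mem_range.2 (coarsen_lt lvl T t)) kt
    have hprice : n * (∑ t ∈ bigS, kt t) + ∑ t ∈ bigS, (n * n - Module.finrank ℂ (Kt t)) ≤ c * (s * m) := by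
      have h1 : ∀ t ∈ bigS, n * kt t + (n * n - Module.finrank ℂ (Kt t)) ≤ c * (s * lvlSize lvl t) := fun t ht =>
        (hKt t (Finset.mem_range.1 (Finset.mem_filter.1 ht).1) (Finset.mem_filter.1 ht).2).2
      calc n * (∑ t ∈ bigS, kt t) + ∑ t ∈ bigS, (n * n - Module.finrank ℂ (Kt t))
          = ∑ t ∈ bigS, (n * kt t + (n * n - Module.finrank ℂ (Kt t))) := by rw [Finset.mul_sum, ← Finset.sum_add_distrib]
        _ ≤ ∑ t ∈ bigS, c * (s * lvlSize lvl t) := Finset.sum_le_sum h1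
        _ = c * (s * ∑ t ∈ bigS, lvlSize lvl t) := by rw [Finset.mul_sum, Finset.mul_sum]
        _ ≤ c * (s * ∑ t ∈ Finset.range L, lvlSize lvl t) :=
          Nat.mul_le_mul_left _ (Nat.mul_le_mul_left _ (Finset.sum_le_sum_of_subset (Finset.filter_subset _ _)))
        _ = c * (s * m) := by rw [sum_lvlSize_eq lvl hlvl]
    have hcodim : n * n - Module.finrank ℂ K ≤ R.card + ∑ t ∈ bigS, (n * n - Module.finrank ℂ (Kt t)) :=
      (codim_inf_le _ _).trans (add_le_add (codim_freezeSpace_le N' R) (codim_finset_inf_le bigS Kt))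
    have hKle := finrank_dir_le n K
    have hPn : (m / T) * n ≤ m * T :=
      calc (m / T) * n ≤ (m / T) * (T * T) := Nat.mul_le_mul_left _ hnT.le
        _ = (m / T * T) * T := by ring
        _ ≤ m * T := Nat.mul_le_mul_right _ (Nat.div_mul_le_self m T)
    have hcs : c * (s * m) + 18 * (m * s) ≤ n * n + n * s := by
      have h1 : (c + 18) * m * s ≤ n * (s + 1) * s := Nat.mul_le_mul_right _ hreg'.le
      nlinarith
    have hns : n * s ≤ 3 * (m * s) := by nlinarith
    have hms : m ≤ m * s := Nat.le_mul_of_pos_right m hs1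
    have hexp : (∑ t ∈ bigS, kt t + (P' - 1) + 1) * n = n * ∑ t ∈ bigS, kt t + 2 * ((m / T) * n) + 2 * n := by
      have h1 : ∑ t ∈ bigS, kt t + (P' - 1) + 1 = ∑ t ∈ bigS, kt t + P' := by omega
      rw [h1, hP'def]; ring
    rw [hsumk]
    have hmT : m * T = m * s + m := by rw [hTdef]; ring
    have hR2 : m * (2 * T) = 2 * (m * s) + 2 * m := by rw [hTdef]; ring
    omega

-- (Sanity check, not re-landed: `slow_of_longMassSlowLawInv` follows from `slow_of_constituent_certs` by feeding the global law to `hcert`;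
-- the statement is already the tree's ✓ `SlowCore.slow_of_longMassSlowLawInv`.)

end LocalGlue

/-! ## §2 Small representations of the permanent contain a (c)-violating irreducible constituent -/

section Violator

variable {n m : ℕ}

/-- ★★★ **SMALL REPRESENTATIONS ARE VIOLATOR FACTORIES.**  If `per_n = tr(N^{n−1}·M)` with `N`, `M` affine, `N^m = 0`, `n ≥ 2` and
`(c+18)²·m² < n³`, then some CONSTITUENT of `N` — a class pencil `B = classPencil (G·N·G') e` of a level-cut constant conjugate — is an
IRREDUCIBLE nilpotent affine pencil of size `b ≥ ⌊√n⌋ + 1` WITHOUT a certificate of price `≤ c·(⌊√n⌋·b)`: a violator of (c)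
`SlowCore.LongMassSlowLawInv` at constant `c`. [this file] -/
theorem exists_expensive_constituent_of_perPoly_eq_trace (c : ℕ) (hn2 : 2 ≤ n) (hreg : (c + 18) ^ 2 * m ^ 2 < n ^ 3)
    (N M : AffMat n m) (hN : IsAffine N) (hnil : N ^ m = 0) (hM : IsAffine M)
    (hper : perPoly (Fin n) ℂ = (N ^ (n - 1) * M).trace) :
    ∃ (b : ℕ) (B : AffMat n b) (G G' : Matrix (Fin m) (Fin m) ℂ) (lvl : Fin m → ℕ) (t : ℕ) (e : {i : Fin m // lvl i = t} ≃ Fin b),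
      G' * G = 1 ∧ G * G' = 1 ∧ LevelCut (G.map C * N * G'.map C) lvl ∧ B = classPencil (G.map C * N * G'.map C) e ∧
      IsAffine B ∧ B ^ b = 0 ∧ IrreducibleInv B ∧ Nat.sqrt n + 1 ≤ b ∧ ¬ RelCert n b B (c * (Nat.sqrt n * b)) := by
  by_contra hnone
  push Not at hnone
  refine not_slow_of_perPoly_eq_trace N M hM hper (slow_of_constituent_certs c hn2 hreg N hN hnil ?_)
  rintro b B hB hBnil hirr hb ⟨G, G', lvl, t, e, hGG, hGG', hcut, hBe⟩
  exact hnone b B G G' lvl t e hGG hGG' hcut hBe hB hBnil hirr hb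

/-- ★★ **In the stub's currency.**  Every unipotent-dual representation of `per_n` of width `m` with `(c+18)²·m² < n³` (`n ≥ 2`) carries a nilpotent
affine pencil `N` (`per_n = tr(N^{n−1}·M)`) one of whose irreducible constituents of size `≥ ⌊√n⌋ + 1` violates (c) at constant `c`.
So a counterexample to the rung `DualUnipotentThreeHalves` at constant `(c+18)²` IS a member of the (empty so far) violator class of (c) at `c`.
[this file] -/
theorem exists_expensive_constituent_of_dualUnipotentRepr (c : ℕ) (hn2 : 2 ≤ n) (hreg : (c + 18) ^ 2 * m ^ 2 < n ^ 3)
    (h : DualUnipotentRepr n m) :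
    ∃ (N M : AffMat n m), IsAffine N ∧ IsAffine M ∧ N ^ m = 0 ∧ perPoly (Fin n) ℂ = (N ^ (n - 1) * M).trace ∧
      ∃ (b : ℕ) (B : AffMat n b) (G G' : Matrix (Fin m) (Fin m) ℂ) (lvl : Fin m → ℕ) (t : ℕ) (e : {i : Fin m // lvl i = t} ≃ Fin b),
        G' * G = 1 ∧ G * G' = 1 ∧ LevelCut (G.map C * N * G'.map C) lvl ∧ B = classPencil (G.map C * N * G'.map C) e ∧
        IsAffine B ∧ B ^ b = 0 ∧ IrreducibleInv B ∧ Nat.sqrt n + 1 ≤ b ∧ ¬ RelCert n b B (c * (Nat.sqrt n * b)) := by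
  obtain ⟨N, M, hN, hM, hnil, hper⟩ := exists_nilpotent_pencil_of_dualUnipotentRepr (by omega) h
  exact ⟨N, M, isAffine_of_isHomogeneous_one N hN, isAffine_of_isHomogeneous_one M hM, hnil, hper,
    exists_expensive_constituent_of_perPoly_eq_trace c hn2 hreg N M (isAffine_of_isHomogeneous_one N hN) hnil
      (isAffine_of_isHomogeneous_one M hM) hper⟩

end Violator

end Summit.ValiantsHypothesis.ValiantsHypothesis.Theorems.GrenetZeon.SlowCore

end
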